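import Summits.QuantumAdvantage.QuantumAdvantage.Theorems.WhiteBoxWalkWbwSuccinctWalkColouring
import Summits.QuantumAdvantage.QuantumAdvantage.Theorems.WhiteBoxWalkWbwSuccinctWalkBipartite

/-!
# App. B's coloured-neighbour map `v_c` at the level of names (the classical function the walk circuit computes)

Helper for the support item `WbwSuccinctWalk` (stmt-QuantumAdvantage-2360) of route
`Summits/QuantumAdvantage/QuantumAdvantage/Theses/WhiteBoxWalk`. In §3.2 of ChildsEtAl2003 the walk
Hamiltonian is simulated as `H = Σ_c V_c T V_c` from the reversible maps
`V_c |a, b, r⟩ = |a, b ⊕ v_c(a), r ⊕ f_c(a)⟩`, where `v_c(a)` is the neighbour of the vertex named `a`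
along colour `c` and `f_c(a) = [there is none]` (the paper's output `11…1`); the one property the
construction uses is `v_c(v_c(a)) = a`. In the circuit-input model the colours are the parity
colours of App. B (companion files `…Colouring`, `…Bipartite`): the walker carries `(a, π)` = (name,
side bit), and `v_{(i,j)}(a, π)` is entry `i` (if `π = 0`) resp. `j` (if `π = 1`) of the adjacency
list at `a`, accepted only if `a` is entry `j` resp. `i` of the adjacency list there; the side bit
flips along the step. This file defines that map from ANY adjacency-list function `L` (the function
a neighbour circuit computes, `colourStep`) and proves, for `L = gluedTreesOracle σ ν`:
* `colourStep_oracle_eq_some_iff` — `v_{(i,j)}(name v, side v) = name w` iff `{v, w}` has colour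
  `(i, j)` (`ColourAdj`); in particular outputs are names of neighbours (`colourStep_oracle_adj`);
* `colourStep_oracle_of_not_name` — invalid names have no coloured neighbours (`L a = []`);
* `colourStep_oracle_involutive` — **`v_c(v_c(a)) = a` with the side bit flipped**, whenever the side
  function separates the endpoints of edges (for `side := parity`: `parity_ne_of_adj`), stated as
  `colourStep L i j (ν w) (!side v) = some (ν v)` after `colourStep L i j (ν v) (side v) = some (ν w)`;
* `colourStep_parity_involutive` — the same for the intended side function `parity`.
[cite: ChildsEtAl2003, §3.2 and App. B (arXiv:quant-ph/0209131)]
-/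

namespace Summit.QuantumAdvantage.QuantumAdvantage.Theorems.WbwSuccinctWalk

open Literature.Computability.QuantumComplexity GluedTrees

variable {N : ℕ}

/-- **App. B's coloured-neighbour map on names.** From the adjacency-list function `L`, colour
`(i, j)`, a name `a` and its side bit: go to entry `i` (side `0`) resp. `j` (side `1`) of `L a`,
provided `a` is entry `j` resp. `i` of the list at that name; `none` otherwise (no edge of colour
`(i, j)` at `a` — the paper's `v_c(a) = 11…1`). [cite: ChildsEtAl2003, §3.2 and App. B] -/
def colourStep (L : (Fin N → Bool) → List (Fin N → Bool)) (i j : ℕ) (a : Fin N → Bool) :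
    Bool → Option (Fin N → Bool)
  | false => ((L a)[i]?).bind fun b => if (L b)[j]? = some a then some b else none
  | true => ((L a)[j]?).bind fun b => if (L b)[i]? = some a then some b else none

/-- The `bind`/`if` pattern of `colourStep`, unfolded. [folklore] -/
theorem bind_ite_eq_some_iff {α : Type*} (o : Option α) (P : α → Prop) [DecidablePred P] (b : α) :
    (o.bind fun b' => if P b' then some b' else none) = some b ↔ o = some b ∧ P b := by
  cases o with
  | none => simp
  | some b' =>
    rw [Option.bind_some]
    by_cases hp : P b'
    · rw [if_pos hp]
      constructor
      · intro e
        cases e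
        exact ⟨rfl, hp⟩
      · rintro ⟨e, -⟩
        cases e
        rfl
    · rw [if_neg hp]
      constructor
      · intro e
        cases e
      · rintro ⟨e, hb⟩
        cases e
        exact absurd hb hp

/-- Unfolding: when `colourStep` returns a name. [cite: ChildsEtAl2003, App. B] -/
theorem colourStep_eq_some_iff (L : (Fin N → Bool) → List (Fin N → Bool)) (i j : ℕ)
    (a : Fin N → Bool) (π : Bool) (b : Fin N → Bool) :
    colourStep L i j a π = some b ↔
      (π = false ∧ (L a)[i]? = some b ∧ (L b)[j]? = some a) ∨
      (π = true ∧ (L a)[j]? = some b ∧ (L b)[i]? = some a) := by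
  cases π
  · simp only [colourStep, bind_ite_eq_some_iff, Bool.false_eq_true, true_and, false_and, or_false,
      iff_self]
  · simp only [colourStep, bind_ite_eq_some_iff, Bool.true_eq_false, true_and, false_and, false_or,
      iff_self]

variable {n : ℕ}

/-- The neighbour-name set at a string naming no vertex is empty (names of any length `N`).
[cite: ChildsEtAl2003, §2] -/
theorem nbrNames_eq_empty_emb (σ : CycleDatum n) (ν : Vertex n ↪ (Fin N → Bool)) {a : Fin N → Bool}
    (h : ∀ v, ν v ≠ a) : nbrNames σ ν a = ∅ := by
  unfold nbrNames
  have : (Finset.univ.filter fun w ↦ ν w = a) = ∅ := by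
    ext w
    simp only [Finset.mem_filter, Finset.mem_univ, true_and, Finset.notMem_empty, iff_false]
    exact h w
  rw [this, Finset.biUnion_empty]

/-- The oracle answers `[]` (INVALID) at a string naming no vertex. [cite: ChildsEtAl2003, §2] -/
theorem gluedTreesOracle_of_not_name (σ : CycleDatum n) (ν : Vertex n ↪ (Fin N → Bool))
    {a : Fin N → Bool} (h : ∀ v, ν v ≠ a) : gluedTreesOracle σ ν a = [] := by
  unfold gluedTreesOracle
  rw [nbrNames_eq_empty_emb σ ν h]
  simp

/-- **Invalid names have no coloured neighbours.** [cite: ChildsEtAl2003, §3.2] -/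
theorem colourStep_oracle_of_not_name (σ : CycleDatum n) (ν : Vertex n ↪ (Fin N → Bool)) (i j : ℕ)
    {a : Fin N → Bool} (h : ∀ v, ν v ≠ a) (π : Bool) :
    colourStep (gluedTreesOracle σ ν) i j a π = none := by
  cases π <;>
    simp only [colourStep, gluedTreesOracle_of_not_name σ ν h, List.getElem?_nil, Option.bind_none]

/-- **`colourStep` computes the parity colouring**: from `(name v, side v)` along colour `(i, j)` it
returns `name w` exactly when `{v, w}` is an edge of colour `(i, j)`. [cite: ChildsEtAl2003, App. B] -/
theorem colourStep_oracle_eq_some_iff (σ : CycleDatum n) (ν : Vertex n ↪ (Fin N → Bool))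
    (side : Vertex n → Bool) (i j : ℕ) (v : Vertex n) (b : Fin N → Bool) :
    colourStep (gluedTreesOracle σ ν) i j (ν v) (side v) = some b ↔
      ∃ w, ν w = b ∧ ColourAdj (graph n σ) side (nbrIdx σ ν) i j v w := by
  rw [colourStep_eq_some_iff]
  constructor
  · intro h
    -- in either case `b` is listed at `ν v`, hence names a neighbour `w`
    have hb : b ∈ gluedTreesOracle σ ν (ν v) := by
      rcases h with ⟨-, h1, -⟩ | ⟨-, h1, -⟩ <;> exact List.mem_of_getElem? h1
    obtain ⟨w, -, rfl⟩ := (mem_gluedTreesOracle_iff σ ν v b).1 hb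
    exact ⟨w, rfl, (colourAdj_iff_oracle side σ ν i j v w).2 h⟩
  · rintro ⟨w, rfl, hc⟩
    exact (colourAdj_iff_oracle side σ ν i j v w).1 hc

/-- Outputs of `colourStep` from a vertex name are names of NEIGHBOURS. [cite: ChildsEtAl2003, §3.2] -/
theorem colourStep_oracle_adj (σ : CycleDatum n) (ν : Vertex n ↪ (Fin N → Bool))
    (side : Vertex n → Bool) (i j : ℕ) {v : Vertex n} {b : Fin N → Bool}
    (h : colourStep (gluedTreesOracle σ ν) i j (ν v) (side v) = some b) :
    ∃ w, ν w = b ∧ (graph n σ).Adj v w := by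
  obtain ⟨w, rfl, hc⟩ := (colourStep_oracle_eq_some_iff σ ν side i j v b).1 h
  exact ⟨w, rfl, hc.adj⟩

/-- **`v_c(v_c(a)) = a`** (the property §3.2's simulation rests on), with the side bit flipped along
the step: if the side function separates the endpoints of every edge, stepping back from the
output with the opposite side bit returns the input. [cite: ChildsEtAl2003, §3.2 and App. B] -/
theorem colourStep_oracle_involutive (σ : CycleDatum n) (ν : Vertex n ↪ (Fin N → Bool))
    (side : Vertex n → Bool) (hside : ∀ ⦃u v : Vertex n⦄, (graph n σ).Adj u v → side u ≠ side v)
    (i j : ℕ) {v w : Vertex n}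
    (h : colourStep (gluedTreesOracle σ ν) i j (ν v) (side v) = some (ν w)) :
    side w = !side v ∧ colourStep (gluedTreesOracle σ ν) i j (ν w) (side w) = some (ν v) := by
  obtain ⟨w', hw', hc⟩ := (colourStep_oracle_eq_some_iff σ ν side i j v (ν w)).1 h
  obtain rfl : w = w' := (ν.injective hw').symm
  refine ⟨?_, (colourStep_oracle_eq_some_iff σ ν side i j w (ν v)).2 ⟨v, rfl, hc.symm hside⟩⟩
  have := hside hc.adj
  cases hv : side v <;> cases hw : side w <;> simp_all

/-- The intended instance: with the side bit `parity` (`…Bipartite`), `colourStep` is an involution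
up to the parity flip, on every glued-trees instance and every colour. [cite: ChildsEtAl2003, App. B] -/
theorem colourStep_parity_involutive (σ : CycleDatum n) (ν : Vertex n ↪ (Fin N → Bool)) (i j : ℕ)
    {v w : Vertex n} (h : colourStep (gluedTreesOracle σ ν) i j (ν v) (parity v) = some (ν w)) :
    parity w = !parity v ∧ colourStep (gluedTreesOracle σ ν) i j (ν w) (parity w) = some (ν v) :=
  colourStep_oracle_involutive σ ν parity (fun _ _ huv ↦ parity_ne_of_adj σ huv) i j h

/-- With `side := parity` the walk Hamiltonian of `G'_n(σ)` (`1 ≤ n`) is `(1/√2)` times the sum of the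
nine SYMMETRIC one-sparse colour matrices whose off-diagonal support is the graph of `colourStep`
(assembling `…Colouring` and `…Bipartite`). [cite: ChildsEtAl2003, §3.2 and App. B] -/
theorem hamiltonian_eq_sum_parityColourMatrix (hn : 1 ≤ n) (σ : CycleDatum n)
    (ν : Vertex n ↪ (Fin N → Bool)) :
    hamiltonian n σ = ((Real.sqrt 2)⁻¹ : ℂ) •
        ∑ i ∈ Finset.range 3, ∑ j ∈ Finset.range 3, colourMatrix (graph n σ) parity (nbrIdx σ ν) ℂ i j ∧
      ∀ i j, (colourMatrix (graph n σ) parity (nbrIdx σ ν) ℂ i j).IsSymm :=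
  ⟨hamiltonian_eq_sum_colourMatrix parity hn σ ν,
    fun i j ↦ colourMatrix_graph_isSymm parity σ ν ℂ (fun _ _ huv ↦ parity_ne_of_adj σ huv) i j⟩

end Summit.QuantumAdvantage.QuantumAdvantage.Theorems.WbwSuccinctWalk
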